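import Mathlib
import HarnessLib
import Summits.AtomisticToContinuum.FouriersLaw.Theses.JunctionLocality
import Summits.AtomisticToContinuum.FouriersLaw.Theorems.JunctionLocalityDefs
import Summits.AtomisticToContinuum.FouriersLaw.Theorems.JunctionLocalityConductanceLowerBoundStubKickResponseIdentity
import Summits.AtomisticToContinuum.FouriersLaw.Theorems.JunctionLocalityConductanceLowerBoundStubShortTimeDipoleFloor
import Summits.AtomisticToContinuum.FouriersLaw.Theorems.HonestZwanzigOpenChainGreenKuboKDN
import Summits.AtomisticToContinuum.FouriersLaw.Theorems.OddSectorIrreversibilityCorrectorTheoryUniformMixing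

/-!
# Line `kick-dipole-no-collapse` — checked skeleton for the crux
`JunctionLocality.ConductanceLowerBound` (item stmt-AtomisticToContinuum-11749, rank 4, the POSITIVITY half
`liminf_N D_N > 0`; routes `route-AtomisticToContinuum-JunctionLocality` (primary),
`route-AtomisticToContinuum-StaticAbelianSqueeze`; support in `ParityLiouvilleSeed`)

crux-plan planner `planner-cruxplan-stmt-AtomisticToContinuum-11749-kick-dipole-no-colla-0`, 2026-08-16.
Idea card `Cruxes/ConductanceLowerBound/Ideas/kick-dipole-no-collapse.md` (ideator 2, round 1; triage r1-1 PASS,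
r1-2 PASS); line card `Lines/kick-dipole-no-collapse.md`.

## The crux (FIXED; concluded BY NAME by `ConductanceLowerBound_of` below)

Along unique weak steady-state families `μ` of `pinnedChain ω₂ lam β γ` (all `> 0`), for every `T > 0` and every
sequence `D` of clause-(ii) response coefficients `D_N = lim_{δ→0,δ≠0} J_N(μ_{N,T+δ/2,T-δ/2})/δ`:
`∃ c > 0 ∃ N₁ ∀ N ≥ N₁, c ≤ D_N`.

## The line (objects of this file)

* `kdnSource γ N = (γ/2)(p_0² − p_{N−1}²)` — the Kundu–Dhar–Narayan source (the tree's `g` of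
  `Theorems.OpenChainGreenKubo.kdn_identity` / `totalCurrent_eq_bias_mul_pairing`, verbatim for `N ≥ 1`);
* `kickKernel (pinnedChain ω₂ lam β γ) N T s = 𝒥_N(s) := T⁻² ∫ g · (P_s J) dμ_T` — the KICK-RESPONSE KERNEL: the mean total
  current `J = Σ_i j_i` at time `s` after the antisymmetric contact kick `g`, in equilibrium at `T` (both baths at
  `T`: constructed kernels `transitionKernel N T T s`, Gibbs measure `gibbsMeasure N T`); `𝒥_N(0) = 0` (parity),
  `𝒥_N'(0) = γ⟨V''(r_0)⟩_T ≥ γ` (Gibbs integration by parts), NON-extensive;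
* `bookedDipole (pinnedChain ω₂ lam β γ) N T t = 𝔇_N(t) := ∫₀ᵗ 𝒥_N` — the BOOKED HEAT DIPOLE (first moment of the heat pushed
  in at the left contact and pulled out at the right one, bath-absorbed heat booked at the absorbing contact).

`D_N = 𝔇_N(∞)` (stub K, the step BEFORE Green–Kubo), so the crux is the statement that ONE bounded response
curve per `N` does not collapse: positivity, not a rate, not an `N²` crossover.

## Registered stubs (lead v5: 3 — K landed, S landed, R open) and the composition

* `stub_kickResponseIdentity` (K; fixed `N`; **LANDED p98460**, `Theorems/JunctionLocalityConductanceLowerBoundStubKickResponseIdentity.lean`,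
  imported) — under the crux's hypotheses, for `N ≥ 2`: `𝒥_N ∈ L¹(0,∞)` and `D_N = ∫₀^∞ 𝒥_N` (★ exact response identity
  `OpenChainGreenKubo.totalCurrent_eq_bias_mul_pairing` + CONT `tendsto_pairing_of_uniform_decay` fed by the δ-uniform CEHR mixing
  `Corrector.uniformDecay_totalCurrent` + uniqueness of limits along `𝓝[≠] 0`).  Consumes ALL load-bearing hypotheses of the crux
  (Disproof §2: steady family, response, `0 < T`; uniqueness passes to ★).
* `stub_shortTimeDipoleFloor` (S; `N`-uniform, MICROSCOPIC time; **LANDED p120252**, imported) — `∃ t₁ > 0 ∀ t₀ ∈ (0,t₁] ∃ m > 0 ∀ N ≥ 2,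
  m ≤ 𝔇_N(t₀)`.  `𝒥_N(0) = 0` (parity), `𝒥_N'(0) = (γ/2)(⟨V''(r_0)⟩_T + ⟨V''(r_{N−2})⟩_T) ≥ γ` (two Gibbs integrations by parts;
  re-derived by the lead), `N`-uniform remainder by LOCALITY IN TIME (near/far split of `J` + the NonBallistic light cone) — the lead
  checked that the global `L²(μ_T)` Cauchy–Schwarz bound on `𝒥_N''` is NOT `N`-uniform (`‖J‖², ‖LJ‖² ≍ N`).  `γ > 0`, `T > 0`
  enter substantively (Disproof §2 `false_without_posTemp`, §3).
* `stub_onsetRetention` (R; THE BET after reshape v4; `N`-uniform; size XL; held by the lead) — `∃ θ > 0 ∃ t₁ > 0 ∀ t₀ ∈ (0,t₁]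
  ∃ N₁ ∀ N ≥ N₁, 𝒥_N ∈ L¹(0,∞) → θ·𝔇_N(t₀) ≤ ∫₀^∞ 𝒥_N`: the terminal booked dipole retains a fixed fraction of its onset value —
  gambler's ruin from site 1 with probability `≳ θ/(N−1)`.  Implied by the planner's finer split (E) ∧ (L/L∞) (§1b, sorry-free
  sufficiency lemmas); their infinite-volume floor (E) is itself crux-hard, so it is not registered separately.
* `ConductanceLowerBound_of` — the kernel-checked composition, concluding the route decl BY NAME
  (real analysis: `D_N = ∫₀^∞ 𝒥_N ≥ θ·𝔇_N(t₀) ≥ θ·m`).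

Triage sharpenings acted on: (r1-1) the card's single `NoDipoleCollapse` is split at a FREE intermediate late
time `τ` into (E) = the finite-window/semi-infinite floor "(F)" and (L) = the late half, `θ, θ₀` free to degrade
with `(ω₂, γ, T, t₀)`, no explicit `γt₀²/4`; (r1-2) no `∀ t₀` pairing of the bet with the floor — (L) chooses its
own LATE reference times (past kinetic first beats), (E) needs the floor only at arbitrarily SMALL `t₀` where (S)
supplies it, so an `N`-independent transient dip `𝔇_∞(t₁) < 0` kills no stub while `t → ∞` is still controlled
(inside (L), where transport re-enters).

Elaboration: `lean check` rc 0; the ONLY sorry is `stub_onsetRetention` (the bet); §1b lemmas closed;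
`ledger skeleton check` registers the four stubs.
-/

noncomputable section

open MeasureTheory Filter Topology Set
open scoped NNReal BigOperators

namespace Summit.AtomisticToContinuum.FouriersLaw.Cruxes.ConductanceLowerBound.KickDipoleNoCollapse

open Literature.MathematicalPhysics.KineticTheory.HeatConduction

/-! ## §0 The objects of the line (route vocabulary)

LEAD v2 (prover-line-stmt-AtomisticToContinuum-11749-c1-0, 2026-08-16): the three objects are route-posited vocabulary and are being
LANDED append-only in `Theorems/JunctionLocalityDefs.lean` (proposal p96548, ACCEPTED 10:34Z, commit b9c7227ed40f) in the
chain-generic form `kdnSource P N`, `kickKernel P N T s`, `bookedDipole P N T t` (`P : OscillatorChain`, `γ = P.γ`; `kickKernel`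
written over the route's `evolve` / `totalCurrentObs`; unfolding lemmas `kdnSource_of_pos`, `kickKernel_def`, `bookedDipole_def`,
`bookedDipole_sub`, `kdnSource_neg_momentum`). -/

open Summit.AtomisticToContinuum.FouriersLaw.Theorems.JunctionLocality
  (kdnSource kickKernel bookedDipole kdnSource_of_pos kickKernel_def bookedDipole_def evolve totalCurrentObs)

/-! ## §1 The registered stubs -/

/-! **K — KICK-RESPONSE IDENTITY: LANDED** (p98460, `Theorems/JunctionLocalityConductanceLowerBoundStubKickResponseIdentity.lean`,
`stub_kickResponseIdentity` in this namespace, imported above; worker-K of lead c1, 2026-08-16): under the crux's hypotheses, for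
`N ≥ 2`, `𝒥_N ∈ L¹(0,∞)` and `D_N = ∫₀^∞ 𝒥_N` — ★ exact response identity + CONT (δ-uniform CEHR mixing) + uniqueness of limits. -/

/-! **S — SHORT-TIME DIPOLE FLOOR: LANDED** (p120252, `Theorems/JunctionLocalityConductanceLowerBoundStubShortTimeDipoleFloor.lean`,
`stub_shortTimeDipoleFloor` in this namespace, imported above; workers S/S2 of lead c1, 2026-08-16, with helpers Aux1–Aux16): the
`N`-UNIFORM short-time floor `∃ t₁ > 0 ∀ t₀ ∈ (0,t₁] ∃ m > 0 ∀ N ≥ 2, m ≤ 𝔇_N(t₀)` — the first `N`-uniform ingredient of the crux landed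
by any line.  Route: `𝒥_N = −(2γ/T²)ψ`, Dynkin ODE `ψ' = −Φ_N − 2γψ` for the contact power pairing `Φ_N(s) = ⟨p_0∂_{q_0}H, κ_sJ⟩_{μ_T}`,
damped comparison, and the `N`-uniform persistence `Φ_N(s) ≥ T²/4` on `[0,t₁]` (`contactPowerPairing_floor`, exposed for reuse) from the
LIGHT CONE WITH LOCAL WEIGHTS (lattice Gronwall series, local Volterra inequality, factorial Gibbs moments, annealed far-bond estimate). -/

/-- **R — ONSET RETENTION (THE BET of the line after the lead's reshape v4; `N`-uniform, size XL).**  For all parameters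
`> 0` and `T > 0` there are `θ > 0` and `t₁ > 0` such that for every onset time `t₀ ∈ (0, t₁]`, eventually in `N`, the
terminal value of the booked dipole retains the fraction `θ` of its onset value: `θ·𝔇_N(t₀) ≤ ∫₀^∞ 𝒥_N (= 𝔇_N(∞) = D_N` by (K)),
the fixed-`N` integrability of `𝒥_N` (supplied by (K) under the crux's hypotheses) being an explicit antecedent.  In the line's
energy-bookkeeping dictionary (lead card v3, B1–B4; `T²𝔇_N(t)/γ = Σ_x x·ε_x(t) + (N−1)·A_×(t)` + mirror, `T²D_N = γ(N−1)A_×(∞)`):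
at a small onset time the kick's excess energy that has left the hot contact sits at distance `1`, so (R) is the GAMBLER'S-RUIN
LOWER BOUND "energy that crossed the first bond reaches the FAR bath with probability `≥ θ/(N−1)`" — exact with `θ → 1` for a
diffusive bulk (booked dipole = stopped martingale), `≫` what is needed at the ballistic anchor (`D_N ≍ N`), and FALSE exactly for a
perfect insulator (Disproof §5: under (A)+(P) the only failure mode of the crux).  WHAT must be proved is unbiasedness of energy
motion in space (escape probability `≳ 1/N`), not speed.  It is implied by the planner's finer split — escape floor (E, `N → ∞`
first) ∧ no late/terminal collapse (L/L∞) — kept below as named propositions with the sufficiency lemma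
`onsetRetention_of_escapeFloor_of_terminalNoCollapse`; those carry an infinite-volume positivity input (E) that is itself
crux-hard, so the registered bet is this single statement.  No printed tool gives it for a deterministic anharmonic chain
(barrier `FixedLengthNoConductivityControl`).  NOT provable by norm decay of the odd forecast (refuted stmt-9139): every estimate
must keep the pairing with the local source `g`. [cite: KunduDharNarayan2009, p. 3] [cite: DeRoeckHuveneers2015] -/
theorem stub_onsetRetention :
    ∀ ω₂ lam β γ : ℝ, 0 < ω₂ → 0 < lam → 0 < β → 0 < γ → ∀ T : ℝ, 0 < T →
      ∃ θ : ℝ, 0 < θ ∧ ∃ t₁ : ℝ, 0 < t₁ ∧ ∀ t₀ : ℝ, 0 < t₀ → t₀ ≤ t₁ → ∃ N₁ : ℕ, ∀ N : ℕ, N₁ ≤ N →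
        IntegrableOn (fun s : ℝ => kickKernel (pinnedChain ω₂ lam β γ) N T s) (Ioi 0) →
          θ * bookedDipole (pinnedChain ω₂ lam β γ) N T t₀ ≤
            ∫ s in Ioi (0 : ℝ), kickKernel (pinnedChain ω₂ lam β γ) N T s := by
  sorry

/-! ## §1b The planner's finer split (NOT registered; SUFFICIENT for `stub_onsetRetention`)

LEAD RESHAPES: v3 replaced the time-uniform "no late collapse" (all `t ≥ τ`) by its terminal form (the composition only uses
`t → ∞`); v4 merges the escape floor (E) and the terminal no-collapse (L∞) into the single onset-retention bet (R), because E's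
floor `inf_{τ ≥ τ₀} lim_N 𝔇_N(τ) > 0` is an infinite-volume transport-positivity statement of the same hardness as the crux, so the
E/L split isolated nothing landable beyond the fixed-`N` identities (landed as helpers by worker-E).  The three propositions and
the two sufficiency lemmas below record the finer split exactly. -/

/-- (E) ESCAPE FLOOR, the planner's `stub_escapeFloor` verbatim as a named proposition: for all small onset times `t₀`,
`∃ θ₀ > 0 ∃ τ₀ ∀ τ ≥ τ₀ ∃ N₁ ∀ N ≥ N₁, θ₀·𝔇_N(t₀) ≤ 𝔇_N(τ)` (`N → ∞` first, then late fixed times). -/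
def EscapeFloor : Prop :=
  ∀ ω₂ lam β γ : ℝ, 0 < ω₂ → 0 < lam → 0 < β → 0 < γ → ∀ T : ℝ, 0 < T →
    ∃ t₁ : ℝ, 0 < t₁ ∧ ∀ t₀ : ℝ, 0 < t₀ → t₀ ≤ t₁ → ∃ θ₀ : ℝ, 0 < θ₀ ∧ ∃ τ₀ : ℝ,
      ∀ τ : ℝ, τ₀ ≤ τ → ∃ N₁ : ℕ, ∀ N : ℕ, N₁ ≤ N →
        θ₀ * bookedDipole (pinnedChain ω₂ lam β γ) N T t₀ ≤ bookedDipole (pinnedChain ω₂ lam β γ) N T τ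

/-- (L) The planner's time-uniform NO LATE COLLAPSE: `∃ θ > 0 ∃ τ₁ ∀ τ ≥ τ₁ ∃ N₁ ∀ N ≥ N₁ ∀ t ≥ τ, θ·𝔇_N(τ) ≤ 𝔇_N(t)`. -/
def NoLateCollapse : Prop :=
  ∀ ω₂ lam β γ : ℝ, 0 < ω₂ → 0 < lam → 0 < β → 0 < γ → ∀ T : ℝ, 0 < T →
    ∃ θ : ℝ, 0 < θ ∧ ∃ τ₁ : ℝ, ∀ τ : ℝ, τ₁ ≤ τ → ∃ N₁ : ℕ, ∀ N : ℕ, N₁ ≤ N →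
      ∀ t : ℝ, τ ≤ t → θ * bookedDipole (pinnedChain ω₂ lam β γ) N T τ ≤ bookedDipole (pinnedChain ω₂ lam β γ) N T t

/-- (L∞) TERMINAL NO COLLAPSE (lead v3): `∃ θ > 0 ∃ τ₁ ∀ τ ≥ τ₁ ∃ N₁ ∀ N ≥ N₁, 𝒥_N ∈ L¹(0,∞) → θ·𝔇_N(τ) ≤ ∫₀^∞ 𝒥_N`. -/
def TerminalNoCollapse : Prop :=
  ∀ ω₂ lam β γ : ℝ, 0 < ω₂ → 0 < lam → 0 < β → 0 < γ → ∀ T : ℝ, 0 < T →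
    ∃ θ : ℝ, 0 < θ ∧ ∃ τ₁ : ℝ, ∀ τ : ℝ, τ₁ ≤ τ → ∃ N₁ : ℕ, ∀ N : ℕ, N₁ ≤ N →
      IntegrableOn (fun s : ℝ => kickKernel (pinnedChain ω₂ lam β γ) N T s) (Ioi 0) →
        θ * bookedDipole (pinnedChain ω₂ lam β γ) N T τ ≤
          ∫ s in Ioi (0 : ℝ), kickKernel (pinnedChain ω₂ lam β γ) N T s

/-- (R) as a named proposition (verbatim `stub_onsetRetention`). -/
def OnsetRetention : Prop :=
  ∀ ω₂ lam β γ : ℝ, 0 < ω₂ → 0 < lam → 0 < β → 0 < γ → ∀ T : ℝ, 0 < T →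
    ∃ θ : ℝ, 0 < θ ∧ ∃ t₁ : ℝ, 0 < t₁ ∧ ∀ t₀ : ℝ, 0 < t₀ → t₀ ≤ t₁ → ∃ N₁ : ℕ, ∀ N : ℕ, N₁ ≤ N →
      IntegrableOn (fun s : ℝ => kickKernel (pinnedChain ω₂ lam β γ) N T s) (Ioi 0) →
        θ * bookedDipole (pinnedChain ω₂ lam β γ) N T t₀ ≤
          ∫ s in Ioi (0 : ℝ), kickKernel (pinnedChain ω₂ lam β γ) N T s

/-- **Time-uniform ⇒ terminal.**  `𝔇_N(t) → ∫₀^∞ 𝒥_N` as `t → ∞` once `𝒥_N ∈ L¹(0,∞)`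
(`intervalIntegral_tendsto_integral_Ioi`), so a bound holding for all `t ≥ τ` passes to the limit (`ge_of_tendsto`). -/
theorem terminalNoCollapse_of_noLateCollapse (h : NoLateCollapse) : TerminalNoCollapse := by
  intro ω₂ lam β γ hω hl hβ hγ T hT
  obtain ⟨θ, hθ, τ₁, hτ₁⟩ := h ω₂ lam β γ hω hl hβ hγ T hT
  refine ⟨θ, hθ, τ₁, fun τ hτ => ?_⟩
  obtain ⟨N₁, hN₁⟩ := hτ₁ τ hτ
  refine ⟨N₁, fun N hN hint => ?_⟩
  have hlim : Tendsto (fun t : ℝ => bookedDipole (pinnedChain ω₂ lam β γ) N T t) atTop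
      (𝓝 (∫ s in Ioi (0 : ℝ), kickKernel (pinnedChain ω₂ lam β γ) N T s)) := by
    simp only [bookedDipole_def]
    exact intervalIntegral_tendsto_integral_Ioi 0 hint tendsto_id
  exact ge_of_tendsto hlim (eventually_atTop.2 ⟨τ, hN₁ N hN⟩)

/-- **Escape floor ∧ terminal no-collapse ⇒ onset retention** (the planner's split is sufficient): with `θ, τ₁` from (L∞) and,
for `t₀ ≤ t₁(E)`, `θ₀, τ₀` from (E), take `τ := max τ₀ τ₁` and `N ≥ N₁(E) ⊔ N₁(L∞)`:
`∫₀^∞ 𝒥_N ≥ θ·𝔇_N(τ) ≥ θ·θ₀·𝔇_N(t₀)`.  The retained fraction `θ·θ₀` may depend on `t₀` through `θ₀`; (R) asks for a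
`t₀`-free `θ`, which (E) supplies as soon as its `θ₀` is `t₀`-free — so the lemma is stated for that uniform variant of (E). -/
theorem onsetRetention_of_escapeFloor_of_terminalNoCollapse
    (hE : ∀ ω₂ lam β γ : ℝ, 0 < ω₂ → 0 < lam → 0 < β → 0 < γ → ∀ T : ℝ, 0 < T →
      ∃ t₁ : ℝ, 0 < t₁ ∧ ∃ θ₀ : ℝ, 0 < θ₀ ∧ ∃ τ₀ : ℝ, ∀ t₀ : ℝ, 0 < t₀ → t₀ ≤ t₁ →
        ∀ τ : ℝ, τ₀ ≤ τ → ∃ N₁ : ℕ, ∀ N : ℕ, N₁ ≤ N →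
          θ₀ * bookedDipole (pinnedChain ω₂ lam β γ) N T t₀ ≤ bookedDipole (pinnedChain ω₂ lam β γ) N T τ)
    (hL : TerminalNoCollapse) : OnsetRetention := by
  intro ω₂ lam β γ hω hl hβ hγ T hT
  obtain ⟨t₁, ht₁, θ₀, hθ₀, τ₀, hE'⟩ := hE ω₂ lam β γ hω hl hβ hγ T hT
  obtain ⟨θ, hθ, τ₁, hL'⟩ := hL ω₂ lam β γ hω hl hβ hγ T hT
  refine ⟨θ * θ₀, by positivity, t₁, ht₁, fun t₀ ht₀ ht₀₁ => ?_⟩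
  obtain ⟨N₁, hN₁⟩ := hE' t₀ ht₀ ht₀₁ (max τ₀ τ₁) (le_max_left _ _)
  obtain ⟨N₂, hN₂⟩ := hL' (max τ₀ τ₁) (le_max_right _ _)
  refine ⟨max N₁ N₂, fun N hN hint => ?_⟩
  have h1 := hN₁ N (le_of_max_le_left hN)
  have h2 := hN₂ N (le_of_max_le_right hN) hint
  calc θ * θ₀ * bookedDipole (pinnedChain ω₂ lam β γ) N T t₀
      = θ * (θ₀ * bookedDipole (pinnedChain ω₂ lam β γ) N T t₀) := by ring
    _ ≤ θ * bookedDipole (pinnedChain ω₂ lam β γ) N T (max τ₀ τ₁) := mul_le_mul_of_nonneg_left h1 hθ.le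
    _ ≤ _ := h2

/-- The registered bet IS the named onset retention (definitional check). -/
theorem onsetRetention_holds : OnsetRetention := stub_onsetRetention

/-! ## §2 The composition (sorry-free) -/

/-- **COMPOSITION (the registered stubs prove the crux BY NAME): K (landed), S, R ⊢ crux.**  Fix parameters, `T`, the
family and its response `D`.  Take `θ, t₁(R)` from (R), `t₁(S)` from (S), the onset time `t₀ := min t₁(S) t₁(R)`, the floor `m`
at `t₀` (S) and `N ≥ N₁(R, t₀) ⊔ 2`.  By (K) `𝒥_N ∈ L¹(0,∞)` and `D_N = ∫₀^∞ 𝒥_N ≥ θ·𝔇_N(t₀) ≥ θ·m =: c > 0`. -/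
theorem ConductanceLowerBound_of :
    Summit.AtomisticToContinuum.FouriersLaw.Theses.JunctionLocality.ConductanceLowerBound := by
  intro ω₂ lam β γ hω hl hβ hγ huniq μ hμ T hT D hD
  obtain ⟨t₁, ht₁, hS'⟩ := stub_shortTimeDipoleFloor ω₂ lam β γ hω hl hβ hγ T hT
  obtain ⟨θ, hθ, t₁', ht₁', hR'⟩ := stub_onsetRetention ω₂ lam β γ hω hl hβ hγ T hT
  have ht₀ : 0 < min t₁ t₁' := lt_min ht₁ ht₁'
  obtain ⟨m, hm, hSm⟩ := hS' (min t₁ t₁') ht₀ (min_le_left _ _)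
  obtain ⟨N₁, hN₁⟩ := hR' (min t₁ t₁') ht₀ (min_le_right _ _)
  refine ⟨θ * m, by positivity, max N₁ 2, fun N hN => ?_⟩
  have hN1 : N₁ ≤ N := le_of_max_le_left hN
  have hN2 : 2 ≤ N := le_of_max_le_right hN
  obtain ⟨hint, hDN⟩ := stub_kickResponseIdentity ω₂ lam β γ hω hl hβ hγ huniq μ hμ T hT D hD N hN2
  rw [hDN]
  calc θ * m ≤ θ * bookedDipole (pinnedChain ω₂ lam β γ) N T (min t₁ t₁') := mul_le_mul_of_nonneg_left (hSm N hN2) hθ.le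
    _ ≤ _ := hN₁ N hN1 hint

end Summit.AtomisticToContinuum.FouriersLaw.Cruxes.ConductanceLowerBound.KickDipoleNoCollapse

end
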